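import Summits.QuantumFields.YangMills.Theorems.LuscherReductionTwistedTraceScalingBODefectCoreRecord
import Summits.QuantumFields.YangMills.Theorems.LuscherReductionTwistedTraceScalingBOCoreCurrency
import Summits.QuantumFields.YangMills.Theorems.LuscherReductionTwistedTraceScalingBORecordGamma
import Summits.QuantumFields.YangMills.Theorems.LuscherReductionTwistedTraceScalingBOBtCFloor
import Summits.QuantumFields.YangMills.Theorems.LuscherReductionTwistedTraceScalingBOFibreBall
import Summits.QuantumFields.YangMills.Theorems.LuscherReductionDressedRitzPolyakovLiftShadowKernelMoment
import HarnessLib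

/-!
# ★★★ (C4) IN THE hOD CURRENCY: `∫_{S_in} E_core² w ≤ (b_core·σ_BT·λ₀)²·‖φ⊗Ω_c‖²_w` eventually, `b_core = (ε_s + κ_P)·√(8/((1−κ_P)(1−β^{-1/5})²(1−κ)))`
# (lane A of S-BASE, crux `TwistedTraceScaling` stmt-QuantumFields-20203, C4-CORE, the (OD) pen; `pub/ym-fleet/ym-luscher-20007-p1/COARSE-DESIGN.md` §30.6 (c))

The (C4)-core `L²(w)` estimate of record (`…BODefectCoreRecord.defect_core_record`) converted into the literal currency of the field `hOD` of `RecordAnalyticInput`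
(`…BODefect.hOD_of_defect`): the comparison scale is `(b β·Λ β)²·tubeNormSq w (boFun φ Ω_c)` with `Λ = σ_BT·λ₀(L³β)`, `σ_BT = btC·Z⁻¹/γ`.  The conversion is
`…BOCoreCurrency.sq_le_of_core_currency` fed with (1) the core bound, (2) `…BOBtCFloor.btC_floor_of_quasimode` (the central quasimode floor exported by `defect_core_record`),
(3) `…BORecordGamma.tubeNormSq_record_ge`, (4) `…BORecordGamma.recordGamma_le_two_mul_inner` (the Hodge/Poincaré mass ratio), (5) `exists_linkCE_le_two_mul_levelValue_zero`;
the hOD window `orbitDist u < 14β^{-s}/|Site|` implies the core window (`…BTWindow`).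
★★★ `core_defect_currency` — for `0 < s ≤ 1/3`, `L ≥ 2`, `M ≥ M₀(L)`, `D ≥ 0`: constants `c₁, C_P, C_Q` with, eventually in `β` (together with `0 < c₁ β`, `κ_P, κ_Q, β^{-1/5} < 1` and the
central quasimode floor of the SAME `c₁` — the conjunct exported by `defect_core_record`, re-exported here for the (C5) pieces), for every bounded measurable `φ` in the hOD window,
`∫ 𝟙_{S_in}(K_core/w − ψ_φ⊗Ω_c)²w ≤ (b_core(β)·(btC·Z⁻¹/γ·λ₀(L³β)))²·tubeNormSq (softWeight χ) (boFun φ Ω_c)`, `b_core(β) = (ε_s(β) + C_P(43β^{-s})²)·√(8/((1−C_P(43β^{-s})²)(1−β^{-1/5})²(1−C_Q(43β^{-s})²)))`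
— `b_core² = O(ε_s² + β^{-4s}) = o(bareLambda(L³β))` for `1/6 < s < 1/4` (`…BOCentralQuasimodeRate.defectRate_hb_small`, `bareLambda ≍ β^{-1/3}`).
WHAT REMAINS for hOD: the complement `S ∖ S_in` (FP tail on the tube `…BODefectTailFP`, gauge-far, and the stiff-separation shell/far estimate, COARSE-DESIGN §30.6 (d)) and the
`hOD_of_defect` packaging with `E = 𝟙_S(K̃(φ⊗Ω_c)/w − ψ_φ⊗Ω_c)`.
HONEST FRAMING: a stub of a child of the CONDITIONAL route R2b1; (C5), the hOD assembly, (B-ST), C4-CORE OPEN; not infinite volume, not a gap, not Clay.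
-/

set_option autoImplicit false

noncomputable section

open MeasureTheory Filter Topology Real
open scoped BigOperators RealInnerProductSpace
open Literature.MathematicalPhysics.QuantumFieldTheory
open Literature.MathematicalPhysics.QuantumLattice

namespace Summit.QuantumFields.YangMills.Theorems.FemtoTransferGap.TwoLattice.ConstTube

open Summit.QuantumFields.YangMills.Theorems.FemtoTransferGap
open Summit.QuantumFields.YangMills.Theorems.FemtoTransferGap.TwoLattice
open Summit.QuantumFields.YangMills.Theorems.FemtoTransferGap.TwoLattice.Avg
open Summit.QuantumFields.YangMills.Theorems.FemtoTransferGap.TwoLattice.Stiff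
open Summit.QuantumFields.YangMills.Theorems.FemtoTransferGap.TwoLattice.GnChart

variable {L : ℕ} [NeZero L]

set_option maxHeartbeats 1600000 in
-- the record expressions are several thousand characters; matching the five inputs against `sq_le_of_core_currency` exceeds the default budget.
/-- ★★★ **(C4) IN THE hOD CURRENCY** (see the module docstring). [cite: Luscher1983, §3] [cite: SjostrandZworski2007, §2] -/
theorem core_defect_currency (hLz : Nonempty (NzSite L)) (hL2 : 2 ≤ L) {s : ℝ} (hs : 0 < s) (hs3 : s ≤ 1 / 3) :
    ∃ M₀ : ℝ, 2 ≤ M₀ ∧ ∀ M : ℝ, M₀ ≤ M → ∀ D : ℝ, 0 ≤ D → ∃ (c₁ : ℝ → ℝ) (Cp Cq : ℝ), 0 ≤ Cp ∧ 0 ≤ Cq ∧ ∀ᶠ β : ℝ in atTop,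
      0 < c₁ β ∧ (Cp * (43 * powScale s β) ^ 2) < 1 ∧ (Cq * (43 * powScale s β) ^ 2) < 1 ∧ powScale (1 / 5) β < 1 ∧
      (∀ v' : Edge 3 L → Fin 3 → ℝ, v' ∈ capBalancedSet L →
      (∀ (e : Edge 3 L) (c : Fin 3), |v' e c| ≤ (9 * (L : ℝ) * (5 * (powScale (1 / 2) β * btLog β ^ 2)) + (powScale 1 β))) → ‖linkEmbed L v'‖ ≤ (min (1 / 40) (powScale (1 / 2) β * btLog β)) / 12 →
      |fpFibreTransfer L β (fun x : LinkSpace L => {x : LinkSpace L | linkCurry x ∈ capBalancedSet L}.indicator (fun _ => (1 : ℝ)) x * frozenProfile L (fun β' => stiffGaussExp L (β' / 2) β') (fun β' => min (1 / 40) (powScale (1 / 2) β' * btLog β')) β x) (coreWeight L (powScale 1 β) (5 * (powScale (1 / 2) β * btLog β ^ 2))) (orthoTube L 1 v') 1 - c₁ β * ((stiffGaussTop L (β / 2) β * Real.exp (-stiffGaussExp L (β / 2) β (linkEmbed L v'))) / (∫ u, ({u : GaugeConfig 3 1 SU2 | (∀ k : Fin 3, ‖su2Quat (u (0, k)) - 1‖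 ≤ (powScale (1 / 3) β)) ∧ (L : ℝ) ^ 3 * wilsonAction su2Rep u ≤ (powScale (1 / 2) β)}.indicator (fun _ => (1 : ℝ))) u * (transferKernel su2Rep ((L : ℝ) ^ 3 * β) (1 : GaugeConfig 3 1 SU2) u / transferKernel su2Rep ((L : ℝ) ^ 3 * β) (1 : GaugeConfig 3 1 SU2) 1)
            ∂configMeasure SU2 1))| ≤ powScale (1 / 5) β * (c₁ β * ((stiffGaussTop L (β / 2) β * Real.exp (-stiffGaussExp L (β / 2) β (linkEmbed L v'))) / (∫ u, ({u : GaugeConfig 3 1 SU2 | (∀ k : Fin 3, ‖su2Quat (u (0, k)) - 1‖ ≤ (powScale (1 / 3) β)) ∧ (L : ℝ) ^ 3 * wilsonAction su2Rep u ≤ (powScale (1 / 2) β)}.indicator (fun _ => (1 : ℝ))) u * (transferKernel su2Rep ((L : ℝ) ^ 3 * β) (1 : GaugeConfig 3 1 SU2) u / transferKernel su2Rep ((L : ℝ) ^ 3 * β) (1 : GaugeConfig 3 1 SU2) 1)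
            ∂configMeasure SU2 1)))) ∧
      ∀ φ : GaugeConfig 3 1 SU2 → ℝ, Measurable φ → ∀ Cφ : ℝ, (∀ u, |φ u| ≤ Cφ) → (∀ u, φ u ≠ 0 → orbitDist u < 14 * powScale s β / Fintype.card (Site 3 L)) →
      ∫ U, {U : GaugeConfig 3 L SU2 | U ∈ orthoTubeSet L ∧ (recordChi L s 43 M β) U ≠ 0 ∧ ‖relLinkVec L U‖ ≤ (min (1 / 40) (powScale (1 / 2) β * btLog β)) / 12 ∧ slowMean L U ∈ {u : GaugeConfig 3 1 SU2 | (∀ k : Fin 3, ‖su2Quat (u (0, k)) - 1‖ ≤ (D * powScale s β)) ∧ (L : ℝ) ^ 3 * wilsonAction su2Rep u ≤ (powScale (2 * s) β)}}.indicator (fun _ => (1 : ℝ)) U *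
          (((fun U : GaugeConfig 3 L SU2 => (fpZ (powScale 1 β))⁻¹ * ∫ u, φ u * (∫ c, fpFibreTransfer L β (fun x : LinkSpace L => {x : LinkSpace L | linkCurry x ∈ capBalancedSet L}.indicator (fun _ => (1 : ℝ)) x * frozenProfile L (fun β' => stiffGaussExp L (β' / 2) β') (fun β' => min (1 / 40) (powScale (1 / 2) β' * btLog β')) β x) (coreWeight L (powScale 1 β) (5 * (powScale (1 / 2) β * btLog β ^ 2))) (gaugeTransform (fun _ : Site 3 L => c⁻¹) U) u ∂haarProbability SU2) ∂configMeasure SU2 1) U / softWeight (recordChi L s 43 M β) U - boFun L (fun u' => (fpZ (powScale 1 β))⁻¹ * (c₁ β * stiffGaussTop L (β / 2) β / (∫ u, ({u : GaugeConfig 3 1 SU2 | (∀ k : Fin 3, ‖su2Quat (u (0, k)) - 1‖ ≤ (powScale (1 / 3) β)) ∧ (L : ℝ) ^ 3 * wilsonAction su2Rep u ≤ (powScale (1 / 2) β)}.indicator (fun _ => (1 : ℝ))) u * (transferKernel su2Rep ((L : ℝ) ^ 3 * β) (1 : GaugeConfig 3 1 SU2) u / transferKernel su2Rep ((L : ℝ)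 ^ 3 * β) (1 : GaugeConfig 3 1 SU2) 1)
            ∂configMeasure SU2 1)) / (fpWeightBar L (powScale 1 β)) * (∫ u, φ u * (avgKernel ((L : ℝ) ^ 3 * β) u' u / transferKernel su2Rep ((L : ℝ) ^ 3 * β) (1 : GaugeConfig 3 1 SU2) 1) ∂configMeasure SU2 1)) (fun x : LinkSpace L => {x : LinkSpace L | linkCurry x ∈ capBalancedSet L}.indicator (fun _ => (1 : ℝ)) x * frozenProfile L (fun β' => stiffGaussExp L (β' / 2) β') (fun β' => min (1 / 40) (powScale (1 / 2) β' * btLog β')) β x) U) ^ 2 * softWeight (recordChi L s 43 M β) U) ∂configMeasure SU2 L ≤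
        (((max (1 - Real.exp (-(coreEta L β (D * powScale s β) ((D * powScale s β) + (14 * powScale s β)) (9 * (L : ℝ) * (5 * (powScale (1 / 2) β * btLog β ^ 2)) + (powScale 1 β)) (min (1 / 40) (powScale (1 / 2) β * btLog β)) ((powScale 1 β) * Fintype.card (Site 3 L)) (powScale (2 * s) β) + coreEps1 L β (D * powScale s β) (9 * (L : ℝ) * (5 * (powScale (1 / 2) β * btLog β ^ 2)) + (powScale 1 β)) (min (1 / 40) (powScale (1 / 2) β * btLog β)) + coreEps2 L β (D * powScale s β) (9 * (L : ℝ) * (5 * (powScale (1 / 2) β * btLog β ^ 2)) + (powScale 1 β)) (min (1 / 40) (powScale (1 / 2) β * btLog β)) (powScale (2 * s) β))) * (1 - powScale (1 / 5) β)) (Real.exp (coreEta L β (D * powScale s β) ((D * powScale s β) + (14 * powScale s β)) (9 * (L : ℝ) * (5 * (powScale (1 / 2) β * btLog β ^ 2)) + (powScale 1 β)) (min (1 / 40) (powScale (1 / 2) β * btLog β)) ((powScale 1 β) * Fintype.card (Site 3 L)) (powScale (2 * s) β) + coreEps1 L β (D * powScale s β) (9 * (L : ℝ) * (5 * (powScale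 (1 / 2) β * btLog β ^ 2)) + (powScale 1 β)) (min (1 / 40) (powScale (1 / 2) β * btLog β)) + coreEps2 L β (D * powScale s β) (9 * (L : ℝ) * (5 * (powScale (1 / 2) β * btLog β ^ 2)) + (powScale 1 β)) (min (1 / 40) (powScale (1 / 2) β * btLog β)) (powScale (2 * s) β)) * (1 + powScale (1 / 5) β) - 1) + (Cp * (43 * powScale s β) ^ 2)) * Real.sqrt (8 / ((1 - (Cp * (43 * powScale s β) ^ 2)) * (1 - powScale (1 / 5) β) ^ 2 * (1 - (Cq * (43 * powScale s β) ^ 2))))) * (btC L β (fun x : LinkSpace L => {x : LinkSpace L | linkCurry x ∈ capBalancedSet L}.indicator (fun _ => (1 : ℝ)) x * frozenProfile L (fun β' => stiffGaussExp L (β' / 2) β') (fun β' => min (1 / 40) (powScale (1 / 2) β' * btLog β')) β x) (powScale 1 β) (5 * (powScale (1 / 2) β * btLog β ^ 2)) * (fpZ (powScale 1 β))⁻¹ / recordGamma L (fun β' => fun x : LinkSpace L => {x : LinkSpace L | linkCurry x ∈ capBalancedSet L}.indicator (fun _ => (1 : ℝ)) x * frozenProfile L (fun β'' => stiffGaussExp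 L (β'' / 2) β'') (fun β'' => min (1 / 40) (powScale (1 / 2) β'' * btLog β'')) β' x) β * levelValue su2Rep 1 ((L : ℝ) ^ 3 * β) 0)) ^ 2 * tubeNormSq (softWeight (recordChi L s 43 M β)) (boFun L φ (fun x : LinkSpace L => {x : LinkSpace L | linkCurry x ∈ capBalancedSet L}.indicator (fun _ => (1 : ℝ)) x * frozenProfile L (fun β' => stiffGaussExp L (β' / 2) β') (fun β' => min (1 / 40) (powScale (1 / 2) β' * btLog β')) β x)) := by
  set N : ℝ := (Fintype.card (Site 3 L) : ℝ) with hNdef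
  have hN : 0 < N := by rw [hNdef]; exact_mod_cast Fintype.card_pos
  have hN1 : 1 ≤ N := by rw [hNdef]; exact_mod_cast Fintype.card_pos
  have hNL : N = (L : ℝ) ^ 3 := by rw [hNdef]; exact card_site_cube L
  obtain ⟨M₀, hM₀, hrec⟩ := defect_core_record (L := L) hLz hs hs3
  obtain ⟨M₀', hM₀', hnorm⟩ := tubeNormSq_record_ge (L := L) hLz hs hs3
  refine ⟨max M₀ M₀', le_trans hM₀ (le_max_left _ _), fun M hM D hD => ?_⟩
  obtain ⟨c₁, Cp, hCp, hcore⟩ := hrec M ((le_max_left _ _).trans hM) D hD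
  obtain ⟨Cq, hCq, hn⟩ := hnorm M ((le_max_right _ _).trans hM)
  refine ⟨c₁, Cp, Cq, hCp, hCq, ?_⟩
  obtain ⟨B₀, hB₀, hCE⟩ := PolyakovLift.exists_linkCE_le_two_mul_levelValue_zero
  have hγ2 := recordGamma_le_two_mul_inner (L := L) hL2
  have eη : ∀ᶠ β : ℝ in atTop, powScale (1 / 5) β < 1 := (tendsto_powScale (σ := 1 / 5) (by norm_num)).eventually (eventually_lt_nhds one_pos)
  have hδ2t : Tendsto (powScale (2 * s)) atTop (𝓝 0) := tendsto_powScale (by linarith)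
  have c3 : (0 : ℝ) < 1 / (12 * (L : ℝ) ^ 3 * (14 / N) ^ 4 + 1) := by positivity
  have eact : ∀ᶠ β : ℝ in atTop, (L : ℝ) ^ 3 * (12 * (14 * powScale s β / N) ^ 4) ≤ powScale (2 * s) β := by
    filter_upwards [hδ2t.eventually (gt_mem_nhds c3)] with β hβ4
    have hmul : powScale s β * powScale s β = powScale (2 * s) β := by
      unfold powScale
      have h0 : 0 < max β 1 := lt_of_lt_of_le one_pos (le_max_right _ _)
      rw [← Real.rpow_add h0]; ring_nf
    have hδ4 : powScale s β ^ 4 = powScale (2 * s) β * powScale (2 * s) β := by rw [← hmul]; ring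
    have hps2 : 0 < powScale (2 * s) β := powScale_pos _ _
    have h2 : (L : ℝ) ^ 3 * (12 * (14 * powScale s β / N) ^ 4) = (12 * (L : ℝ) ^ 3 * (14 / N) ^ 4 * powScale (2 * s) β) * powScale (2 * s) β := by
      rw [show 14 * powScale s β / N = 14 / N * powScale s β by ring, mul_pow, hδ4]; ring
    have h3 : 12 * (L : ℝ) ^ 3 * (14 / N) ^ 4 * powScale (2 * s) β ≤ 1 := by
      have := (lt_div_iff₀ (by positivity : (0 : ℝ) < 12 * (L : ℝ) ^ 3 * (14 / N) ^ 4 + 1)).mp hβ4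
      nlinarith [hps2]
    rw [h2]
    calc (12 * (L : ℝ) ^ 3 * (14 / N) ^ 4 * powScale (2 * s) β) * powScale (2 * s) β ≤ 1 * powScale (2 * s) β := mul_le_mul_of_nonneg_right h3 hps2.le
      _ = powScale (2 * s) β := one_mul _
  filter_upwards [hcore, hn, hγ2, eη, eact, eventually_gt_atTop (0 : ℝ), eventually_ge_atTop B₀] with β HC HN Hγ hη hact hβ0 hβB
  obtain ⟨hc₁, hκP, hfloor, hdef⟩ := HC
  obtain ⟨hκQ, hnφ⟩ := HN
  refine ⟨hc₁, hκP, hκQ, hη, hfloor, fun φ hφm Cφ hCφ hφs => ?_⟩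
  -- the hOD window implies the core window
  have hwin : (∀ u, φ u ≠ 0 → (∀ k : Fin 3, ‖su2Quat (u (0, k)) - 1‖ ≤ (14 * powScale s β)) ∧ (L : ℝ) ^ 3 * wilsonAction su2Rep u ≤ (powScale (2 * s) β)) := by
    intro u hu
    have hod := hφs u hu
    have hq : ∀ e : Edge 3 1, ‖su2Quat (u e) - 1‖ ≤ 14 * powScale s β / N := fun e => (norm_su2Quat_sub_one_le_orbitDist u e).trans hod.le
    refine ⟨fun k => (hq (0, k)).trans (div_le_self (mul_nonneg (by norm_num) (powScale_pos s β).le) hN1), ?_⟩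
    have hS := wilsonAction_one_site_le u hq
    exact (mul_le_mul_of_nonneg_left hS (by positivity)).trans hact
  have h1 := hdef φ hφm Cφ hCφ hwin
  have h2 := btC_floor_of_quasimode (L := L) hβ0 hfloor
  have h3 := hnφ φ hφm Cφ hCφ hφs
  have hB : B₀ ≤ (L : ℝ) ^ 3 * β := by
    have hL1 : (1 : ℝ) ≤ (L : ℝ) ^ 3 := by rw [← hNL]; exact hN1
    nlinarith
  have h5 := hCE ((L : ℝ) ^ 3 * β) hB
  -- positivity of the data
  have hZi : 0 < (fpZ (powScale 1 β))⁻¹ := inv_pos.2 (fpZ_pos (powScale_pos 1 β))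
  obtain ⟨hSlo, -⟩ := stiffGaussTop_record_bounds (L := L) hβ0
  have hS : 0 < stiffGaussTop L (β / 2) β := lt_of_lt_of_le (pow_pos (Real.sqrt_pos.2 (by positivity)) _) hSlo
  have hI0 : 0 < (∫ u, ({u : GaugeConfig 3 1 SU2 | (∀ k : Fin 3, ‖su2Quat (u (0, k)) - 1‖ ≤ (powScale (1 / 3) β)) ∧ (L : ℝ) ^ 3 * wilsonAction su2Rep u ≤ (powScale (1 / 2) β)}.indicator (fun _ => (1 : ℝ))) u * (transferKernel su2Rep ((L : ℝ) ^ 3 * β) (1 : GaugeConfig 3 1 SU2) u / transferKernel su2Rep ((L : ℝ) ^ 3 * β) (1 : GaugeConfig 3 1 SU2) 1)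
            ∂configMeasure SU2 1) := slowWindow_I0_pos (L := L) (powScale_pos (1 / 3) β) (powScale_pos (1 / 2) β) ((L : ℝ) ^ 3 * β)
  have ha₀ : 0 ≤ c₁ β * stiffGaussTop L (β / 2) β / (∫ u, ({u : GaugeConfig 3 1 SU2 | (∀ k : Fin 3, ‖su2Quat (u (0, k)) - 1‖ ≤ (powScale (1 / 3) β)) ∧ (L : ℝ) ^ 3 * wilsonAction su2Rep u ≤ (powScale (1 / 2) β)}.indicator (fun _ => (1 : ℝ))) u * (transferKernel su2Rep ((L : ℝ) ^ 3 * β) (1 : GaugeConfig 3 1 SU2) u / transferKernel su2Rep ((L : ℝ) ^ 3 * β) (1 : GaugeConfig 3 1 SU2) 1)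
            ∂configMeasure SU2 1) := by positivity
  have hNb : 0 < fpWeightBar L (powScale 1 β) := fpWeightBar_pos L (powScale_pos 1 β)
  have hrf : 0 < min (1 / 40) (powScale (1 / 2) β * btLog β) / 12 :=
    div_pos (lt_min (by norm_num) (mul_pos (powScale_pos _ _) (lt_of_lt_of_le one_pos (one_le_btLog β)))) (by norm_num)
  have hM2 : 0 < (∫ v, {v : Edge 3 L → Fin 3 → ℝ | ‖linkEmbed L v‖ ≤ (min (1 / 40) (powScale (1 / 2) β * btLog β)) / 12}.indicator (fun _ => (1 : ℝ)) v *
            (Real.exp (-((fun β' => stiffGaussExp L (β' / 2) β') β (linkEmbed L v))) ^ 2 * Real.exp (-(‖(gaugeModes L).starProjection (linkEmbed L v)‖ ^ 2 / powScale 1 β ^ 2))) ∂orthoTransverse L) := by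
    have hlow := inner_gauss_mass_ge (L := L) (t := β / 2) (b := β) (s := powScale 1 β) (ρ := min (1 / 40) (powScale (1 / 2) β * btLog β) / 12)
      (R := min (1 / 40) (powScale (1 / 2) β * btLog β) / 12) (by positivity) hβ0.le (powScale_pos 1 β) le_rfl
    have hball := orthoTransverse_real_ball_ge (L := L) hrf
    have hballpos : 0 < (orthoTransverse L).real {v | ‖linkEmbed L v‖ < min (1 / 40) (powScale (1 / 2) β * btLog β) / 12} :=
      lt_of_lt_of_le (pow_pos (div_pos (pow_pos (lt_min (by norm_num) (div_pos (pow_pos hrf 2) (by positivity))) 3) (by norm_num)) _) hball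
    have hpos : 0 < Real.exp (-((2 * (96 * (β / 2) + β) + 1 / powScale 1 β ^ 2) * (min (1 / 40) (powScale (1 / 2) β * btLog β) / 12) ^ 2)) *
        (orthoTransverse L).real {v | ‖linkEmbed L v‖ < min (1 / 40) (powScale (1 / 2) β * btLog β) / 12} :=
      mul_pos (Real.exp_pos _) hballpos
    exact lt_of_lt_of_le hpos hlow
  have hK₁ : 0 < transferKernel su2Rep ((L : ℝ) ^ 3 * β) (1 : GaugeConfig 3 1 SU2) 1 := transferKernel_pos _ _ _ _
  have hφ2 : 0 ≤ ∫ u, φ u ^ 2 ∂configMeasure SU2 1 := integral_nonneg fun u => sq_nonneg _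
  have hγ : 0 < recordGamma L (fun β' => fun x : LinkSpace L => {x : LinkSpace L | linkCurry x ∈ capBalancedSet L}.indicator (fun _ => (1 : ℝ)) x * frozenProfile L (fun β'' => stiffGaussExp L (β'' / 2) β'') (fun β'' => min (1 / 40) (powScale (1 / 2) β'' * btLog β'')) β' x) β := by
    rw [recordGamma_eq]
    have hlow' := inner_gauss_mass_ge (L := L) (t := β / 2) (b := β) (s := powScale 1 β) (ρ := min (1 / 40) (powScale (1 / 2) β * btLog β) / 12)
      (R := min (1 / 40) (powScale (1 / 2) β * btLog β)) (by positivity) hβ0.le (powScale_pos 1 β) (by linarith [hrf])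
    have hball := orthoTransverse_real_ball_ge (L := L) hrf
    have hballpos : 0 < (orthoTransverse L).real {v | ‖linkEmbed L v‖ < min (1 / 40) (powScale (1 / 2) β * btLog β) / 12} :=
      lt_of_lt_of_le (pow_pos (div_pos (pow_pos (lt_min (by norm_num) (div_pos (pow_pos hrf 2) (by positivity))) 3) (by norm_num)) _) hball
    have hpos : 0 < Real.exp (-((2 * (96 * (β / 2) + β) + 1 / powScale 1 β ^ 2) * (min (1 / 40) (powScale (1 / 2) β * btLog β) / 12) ^ 2)) *
        (orthoTransverse L).real {v | ‖linkEmbed L v‖ < min (1 / 40) (powScale (1 / 2) β * btLog β) / 12} :=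
      mul_pos (Real.exp_pos _) hballpos
    exact mul_pos hNb (lt_of_lt_of_le hpos hlow')
  have hΛ₁ : 0 ≤ linkCE ((L : ℝ) ^ 3 * β) := (linkCE_pos (by positivity)).le
  exact sq_le_of_core_currency (Zi := (fpZ (powScale 1 β))⁻¹) (a₀ := c₁ β * stiffGaussTop L (β / 2) β / (∫ u, ({u : GaugeConfig 3 1 SU2 | (∀ k : Fin 3, ‖su2Quat (u (0, k)) - 1‖ ≤ (powScale (1 / 3) β)) ∧ (L : ℝ) ^ 3 * wilsonAction su2Rep u ≤ (powScale (1 / 2) β)}.indicator (fun _ => (1 : ℝ))) u * (transferKernel su2Rep ((L : ℝ) ^ 3 * β) (1 : GaugeConfig 3 1 SU2) u / transferKernel su2Rep ((L : ℝ) ^ 3 * β) (1 : GaugeConfig 3 1 SU2) 1)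
            ∂configMeasure SU2 1)) (ε := max (1 - Real.exp (-(coreEta L β (D * powScale s β) ((D * powScale s β) + (14 * powScale s β)) (9 * (L : ℝ) * (5 * (powScale (1 / 2) β * btLog β ^ 2)) + (powScale 1 β)) (min (1 / 40) (powScale (1 / 2) β * btLog β)) ((powScale 1 β) * Fintype.card (Site 3 L)) (powScale (2 * s) β) + coreEps1 L β (D * powScale s β) (9 * (L : ℝ) * (5 * (powScale (1 / 2) β * btLog β ^ 2)) + (powScale 1 β)) (min (1 / 40) (powScale (1 / 2) β * btLog β)) + coreEps2 L β (D * powScale s β) (9 * (L : ℝ) * (5 * (powScale (1 / 2) β * btLog β ^ 2)) + (powScale 1 β)) (min (1 / 40) (powScale (1 / 2) β * btLog β)) (powScale (2 * s) β))) * (1 - powScale (1 / 5) β)) (Real.exp (coreEta L β (D * powScale s β) ((D * powScale s β) + (14 * powScale s β)) (9 * (L : ℝ) * (5 * (powScale (1 / 2) β * btLog β ^ 2)) + (powScale 1 β)) (min (1 / 40) (powScale (1 / 2) β * btLog β)) ((powScale 1 β) * Fintype.card (Site 3 L)) (powScale (2 * s) β) + coreEps1 L β (D * powScale s β) (9 *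 (L : ℝ) * (5 * (powScale (1 / 2) β * btLog β ^ 2)) + (powScale 1 β)) (min (1 / 40) (powScale (1 / 2) β * btLog β)) + coreEps2 L β (D * powScale s β) (9 * (L : ℝ) * (5 * (powScale (1 / 2) β * btLog β ^ 2)) + (powScale 1 β)) (min (1 / 40) (powScale (1 / 2) β * btLog β)) (powScale (2 * s) β)) * (1 + powScale (1 / 5) β) - 1)) (κP := (Cp * (43 * powScale s β) ^ 2)) (Nbar := fpWeightBar L (powScale 1 β))
    (M2in := (∫ v, {v : Edge 3 L → Fin 3 → ℝ | ‖linkEmbed L v‖ ≤ (min (1 / 40) (powScale (1 / 2) β * btLog β)) / 12}.indicator (fun _ => (1 : ℝ)) v *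
            (Real.exp (-((fun β' => stiffGaussExp L (β' / 2) β') β (linkEmbed L v))) ^ 2 * Real.exp (-(‖(gaugeModes L).starProjection (linkEmbed L v)‖ ^ 2 / powScale 1 β ^ 2))) ∂orthoTransverse L)) (Λ₁ := linkCE ((L : ℝ) ^ 3 * β)) (K₁ := transferKernel su2Rep ((L : ℝ) ^ 3 * β) (1 : GaugeConfig 3 1 SU2) 1) (φ2 := ∫ u, φ u ^ 2 ∂configMeasure SU2 1) (btC := btC L β (fun x : LinkSpace L => {x : LinkSpace L | linkCurry x ∈ capBalancedSet L}.indicator (fun _ => (1 : ℝ)) x * frozenProfile L (fun β' => stiffGaussExp L (β' / 2) β') (fun β' => min (1 / 40) (powScale (1 / 2) β' * btLog β')) β x) (powScale 1 β) (5 * (powScale (1 / 2) β * btLog β ^ 2))) (η := powScale (1 / 5) β) (γ := recordGamma L (fun β' => fun x : LinkSpace L => {x : LinkSpace L | linkCurry x ∈ capBalancedSet L}.indicator (fun _ => (1 : ℝ)) x * frozenProfile L (fun β'' => stiffGaussExp L (β'' / 2) β'') (fun β'' => min (1 / 40) (powScale (1 / 2) β'' * btLog β'')) β' x) β) (κ :=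 (Cq * (43 * powScale s β) ^ 2)) (lam0 := levelValue su2Rep 1 ((L : ℝ) ^ 3 * β) 0)
    hZi ha₀ hNb hM2 hK₁ hφ2 hη hκP hκQ hγ hΛ₁ h1 h2 h3 Hγ h5

end Summit.QuantumFields.YangMills.Theorems.FemtoTransferGap.TwoLattice.ConstTube

end
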